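import Summits.Ventures.HSemireg.Pad4TowerLineDesignCert12Closure

/-!
# Pad4Tower ∕ LineDesignCert12 — KERNEL DECIDES (7∕7, `XPlus4`): guarded X⁺ (the `X` family of the dual-0 world `cfgd`) at dual heads of chunks 60–78 of 78

Tree cut of the KERNEL CERTIFICATE `Cert12`: the `decide +kernel` theorems of this module are, by NAME, STATEMENT and PROOF, those of the farm-certified
Cruxes-level parts `CeilingLineCert12A–E` (split5); the module boundary is set by the gate's build budget only. Each theorem is one static-family check at a few
heads of the design `cfg` of `Pad4TowerLineDesignCert12Closure`; the assembly is in `Pad4TowerLineDesignCert12`.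

MODULE SET (tree cut of ONE certificate; one namespace `Summit.Ventures.HSemireg.Pad4Tower.LineDesignCert12`): `…Cert12DataN` ∕ `DataP` ∕ `DataPd` ∕ `DataNd` (the support and its literal
dual-0 world, DATA ONLY) → `…Cert12Closure` (key-chain `Nodup`, the design `cfg`, the literal dual `cfgd` and `cfg_dual_eq`, ◇₁₂, the ceiling line, per-chunk
G₁ closure ⇒ `cfg` is Δ- and S₄-closed) → `…Cert12RuleD1` ∕ `…Cert12RuleD2` ∕ `…Cert12RuleD3` ∕ `…Cert12XPlus1` ∕ `…Cert12XPlus2` ∕ `…Cert12XPlus3` ∕ `…Cert12XPlus4` (the RULE D (μ₄, M) resp. guarded X⁺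
decides, a few heads per theorem, module boundaries set by the gate's build budget only) → `Pad4TowerLineDesignCert12` (assembly `cfg_staticH1` and the
UNCONDITIONAL doors `¬ SeedB1OddDiamondG1H1 12`, `¬ SeedB1OddConeG1H1`, `¬ SeedB1OddDiamondG1H1 h'` (12 ≤ h'), the LINE shape, every support cell's realisability).

NOTHING IN THIS MODULE SET SAYS THAT HC ∕ HC_CM ∕ HC_AV ∕ H2 ∕ stmt-HodgeConjecture-18881 HOLDS OR FAILS (HC_CM is a displayed binder of the
ladder only); the certified statements concern the typed FIRST-ORDER static game (`RuleDMu4Closed`, `XPlusClosed`, `A2IMinusClosed` = `MConfig.StaticH1`)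
of ONE explicit finite support — first order is necessary, not sufficient, for a seed; no σ, no seed, no census row. `decide +kernel` only: NO `native_decide`,
no `sorry`, no `axiom`, no `instance`, no notation, no Literature fact, no new `def … : Prop`.
-/

set_option linter.dupNamespace false

namespace Summit.Ventures.HSemireg.Pad4Tower.LineDesignCert12

open Summit.Ventures.HSemireg Summit.Ventures.HSemireg.Pad4Tower

set_option maxRecDepth 32768
set_option Elab.async false
set_option synthInstance.maxSize 8192
set_option synthInstance.maxHeartbeats 2000000
set_option maxHeartbeats 8000000

/-! guarded X⁺ (the `X` family of the dual-0 world `cfgd`), heads chunked (6 per theorem) -/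

/-- no `X`-family instance of the dual-0 world fires at the heads of dual chunk 60∕78 (guarded form, `xresXClosed_iff_guarded'`). [kernel `decide`] -/
theorem xplus_60 : ∀ Z ∈ lPd_60, ∀ σ : Fin 4, ¬ isApex (Z σ) → ∀ u : Fin 4, ∀ q ∈ sNd, UPartner Z q σ u → ∀ w : Fin 4, ∀ n ∈ sPd,
    Sibling q n σ w → ∀ f : Fin 4, ¬ XresXFires cfgd Z q n σ u w f := by decide +kernel
/-- no `X`-family instance of the dual-0 world fires at the heads of dual chunk 61∕78 (guarded form, `xresXClosed_iff_guarded'`). [kernel `decide`] -/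
theorem xplus_61 : ∀ Z ∈ lPd_61, ∀ σ : Fin 4, ¬ isApex (Z σ) → ∀ u : Fin 4, ∀ q ∈ sNd, UPartner Z q σ u → ∀ w : Fin 4, ∀ n ∈ sPd,
    Sibling q n σ w → ∀ f : Fin 4, ¬ XresXFires cfgd Z q n σ u w f := by decide +kernel
/-- no `X`-family instance of the dual-0 world fires at the heads of dual chunk 62∕78 (guarded form, `xresXClosed_iff_guarded'`). [kernel `decide`] -/
theorem xplus_62 : ∀ Z ∈ lPd_62, ∀ σ : Fin 4, ¬ isApex (Z σ) → ∀ u : Fin 4, ∀ q ∈ sNd, UPartner Z q σ u → ∀ w : Fin 4, ∀ n ∈ sPd,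
    Sibling q n σ w → ∀ f : Fin 4, ¬ XresXFires cfgd Z q n σ u w f := by decide +kernel
/-- no `X`-family instance of the dual-0 world fires at the heads of dual chunk 63∕78 (guarded form, `xresXClosed_iff_guarded'`). [kernel `decide`] -/
theorem xplus_63 : ∀ Z ∈ lPd_63, ∀ σ : Fin 4, ¬ isApex (Z σ) → ∀ u : Fin 4, ∀ q ∈ sNd, UPartner Z q σ u → ∀ w : Fin 4, ∀ n ∈ sPd,
    Sibling q n σ w → ∀ f : Fin 4, ¬ XresXFires cfgd Z q n σ u w f := by decide +kernel
/-- no `X`-family instance of the dual-0 world fires at the heads of dual chunk 64∕78 (guarded form, `xresXClosed_iff_guarded'`). [kernel `decide`] -/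
theorem xplus_64 : ∀ Z ∈ lPd_64, ∀ σ : Fin 4, ¬ isApex (Z σ) → ∀ u : Fin 4, ∀ q ∈ sNd, UPartner Z q σ u → ∀ w : Fin 4, ∀ n ∈ sPd,
    Sibling q n σ w → ∀ f : Fin 4, ¬ XresXFires cfgd Z q n σ u w f := by decide +kernel
/-- no `X`-family instance of the dual-0 world fires at the heads of dual chunk 65∕78 (guarded form, `xresXClosed_iff_guarded'`). [kernel `decide`] -/
theorem xplus_65 : ∀ Z ∈ lPd_65, ∀ σ : Fin 4, ¬ isApex (Z σ) → ∀ u : Fin 4, ∀ q ∈ sNd, UPartner Z q σ u → ∀ w : Fin 4, ∀ n ∈ sPd,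
    Sibling q n σ w → ∀ f : Fin 4, ¬ XresXFires cfgd Z q n σ u w f := by decide +kernel
/-- no `X`-family instance of the dual-0 world fires at the heads of dual chunk 66∕78 (guarded form, `xresXClosed_iff_guarded'`). [kernel `decide`] -/
theorem xplus_66 : ∀ Z ∈ lPd_66, ∀ σ : Fin 4, ¬ isApex (Z σ) → ∀ u : Fin 4, ∀ q ∈ sNd, UPartner Z q σ u → ∀ w : Fin 4, ∀ n ∈ sPd,
    Sibling q n σ w → ∀ f : Fin 4, ¬ XresXFires cfgd Z q n σ u w f := by decide +kernel
/-- no `X`-family instance of the dual-0 world fires at the heads of dual chunk 67∕78 (guarded form, `xresXClosed_iff_guarded'`). [kernel `decide`] -/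
theorem xplus_67 : ∀ Z ∈ lPd_67, ∀ σ : Fin 4, ¬ isApex (Z σ) → ∀ u : Fin 4, ∀ q ∈ sNd, UPartner Z q σ u → ∀ w : Fin 4, ∀ n ∈ sPd,
    Sibling q n σ w → ∀ f : Fin 4, ¬ XresXFires cfgd Z q n σ u w f := by decide +kernel
/-- no `X`-family instance of the dual-0 world fires at the heads of dual chunk 68∕78 (guarded form, `xresXClosed_iff_guarded'`). [kernel `decide`] -/
theorem xplus_68 : ∀ Z ∈ lPd_68, ∀ σ : Fin 4, ¬ isApex (Z σ) → ∀ u : Fin 4, ∀ q ∈ sNd, UPartner Z q σ u → ∀ w : Fin 4, ∀ n ∈ sPd,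
    Sibling q n σ w → ∀ f : Fin 4, ¬ XresXFires cfgd Z q n σ u w f := by decide +kernel
/-- no `X`-family instance of the dual-0 world fires at the heads of dual chunk 69∕78 (guarded form, `xresXClosed_iff_guarded'`). [kernel `decide`] -/
theorem xplus_69 : ∀ Z ∈ lPd_69, ∀ σ : Fin 4, ¬ isApex (Z σ) → ∀ u : Fin 4, ∀ q ∈ sNd, UPartner Z q σ u → ∀ w : Fin 4, ∀ n ∈ sPd,
    Sibling q n σ w → ∀ f : Fin 4, ¬ XresXFires cfgd Z q n σ u w f := by decide +kernel
/-- no `X`-family instance of the dual-0 world fires at the heads of dual chunk 70∕78 (guarded form, `xresXClosed_iff_guarded'`). [kernel `decide`] -/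
theorem xplus_70 : ∀ Z ∈ lPd_70, ∀ σ : Fin 4, ¬ isApex (Z σ) → ∀ u : Fin 4, ∀ q ∈ sNd, UPartner Z q σ u → ∀ w : Fin 4, ∀ n ∈ sPd,
    Sibling q n σ w → ∀ f : Fin 4, ¬ XresXFires cfgd Z q n σ u w f := by decide +kernel
/-- no `X`-family instance of the dual-0 world fires at the heads of dual chunk 71∕78 (guarded form, `xresXClosed_iff_guarded'`). [kernel `decide`] -/
theorem xplus_71 : ∀ Z ∈ lPd_71, ∀ σ : Fin 4, ¬ isApex (Z σ) → ∀ u : Fin 4, ∀ q ∈ sNd, UPartner Z q σ u → ∀ w : Fin 4, ∀ n ∈ sPd,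
    Sibling q n σ w → ∀ f : Fin 4, ¬ XresXFires cfgd Z q n σ u w f := by decide +kernel
/-- no `X`-family instance of the dual-0 world fires at the heads of dual chunk 72∕78 (guarded form, `xresXClosed_iff_guarded'`). [kernel `decide`] -/
theorem xplus_72 : ∀ Z ∈ lPd_72, ∀ σ : Fin 4, ¬ isApex (Z σ) → ∀ u : Fin 4, ∀ q ∈ sNd, UPartner Z q σ u → ∀ w : Fin 4, ∀ n ∈ sPd,
    Sibling q n σ w → ∀ f : Fin 4, ¬ XresXFires cfgd Z q n σ u w f := by decide +kernel
/-- no `X`-family instance of the dual-0 world fires at the heads of dual chunk 73∕78 (guarded form, `xresXClosed_iff_guarded'`). [kernel `decide`] -/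
theorem xplus_73 : ∀ Z ∈ lPd_73, ∀ σ : Fin 4, ¬ isApex (Z σ) → ∀ u : Fin 4, ∀ q ∈ sNd, UPartner Z q σ u → ∀ w : Fin 4, ∀ n ∈ sPd,
    Sibling q n σ w → ∀ f : Fin 4, ¬ XresXFires cfgd Z q n σ u w f := by decide +kernel
/-- no `X`-family instance of the dual-0 world fires at the heads of dual chunk 74∕78 (guarded form, `xresXClosed_iff_guarded'`). [kernel `decide`] -/
theorem xplus_74 : ∀ Z ∈ lPd_74, ∀ σ : Fin 4, ¬ isApex (Z σ) → ∀ u : Fin 4, ∀ q ∈ sNd, UPartner Z q σ u → ∀ w : Fin 4, ∀ n ∈ sPd,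
    Sibling q n σ w → ∀ f : Fin 4, ¬ XresXFires cfgd Z q n σ u w f := by decide +kernel
/-- no `X`-family instance of the dual-0 world fires at the heads of dual chunk 75∕78 (guarded form, `xresXClosed_iff_guarded'`). [kernel `decide`] -/
theorem xplus_75 : ∀ Z ∈ lPd_75, ∀ σ : Fin 4, ¬ isApex (Z σ) → ∀ u : Fin 4, ∀ q ∈ sNd, UPartner Z q σ u → ∀ w : Fin 4, ∀ n ∈ sPd,
    Sibling q n σ w → ∀ f : Fin 4, ¬ XresXFires cfgd Z q n σ u w f := by decide +kernel
/-- no `X`-family instance of the dual-0 world fires at the heads of dual chunk 76∕78 (guarded form, `xresXClosed_iff_guarded'`). [kernel `decide`] -/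
theorem xplus_76 : ∀ Z ∈ lPd_76, ∀ σ : Fin 4, ¬ isApex (Z σ) → ∀ u : Fin 4, ∀ q ∈ sNd, UPartner Z q σ u → ∀ w : Fin 4, ∀ n ∈ sPd,
    Sibling q n σ w → ∀ f : Fin 4, ¬ XresXFires cfgd Z q n σ u w f := by decide +kernel
/-- no `X`-family instance of the dual-0 world fires at the heads of dual chunk 77∕78 (guarded form, `xresXClosed_iff_guarded'`). [kernel `decide`] -/
theorem xplus_77 : ∀ Z ∈ lPd_77, ∀ σ : Fin 4, ¬ isApex (Z σ) → ∀ u : Fin 4, ∀ q ∈ sNd, UPartner Z q σ u → ∀ w : Fin 4, ∀ n ∈ sPd,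
    Sibling q n σ w → ∀ f : Fin 4, ¬ XresXFires cfgd Z q n σ u w f := by decide +kernel
/-- no `X`-family instance of the dual-0 world fires at the heads of dual chunk 78∕78 (guarded form, `xresXClosed_iff_guarded'`). [kernel `decide`] -/
theorem xplus_78 : ∀ Z ∈ lPd_78, ∀ σ : Fin 4, ¬ isApex (Z σ) → ∀ u : Fin 4, ∀ q ∈ sNd, UPartner Z q σ u → ∀ w : Fin 4, ∀ n ∈ sPd,
    Sibling q n σ w → ∀ f : Fin 4, ¬ XresXFires cfgd Z q n σ u w f := by decide +kernel

end Summit.Ventures.HSemireg.Pad4Tower.LineDesignCert12
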